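import Summits.QuantumFields.YangMills.Theorems.BalabanUVNodesN21GappedRoadN20Invariance
import Summits.QuantumFields.YangMills.Theorems.BalabanUVNodesN21TopLetteredReading13CoPHSanity

/-!
# N21 (NE7c) · THE TOP 𝐑-STEP OF RECORD IS WEIGHT-NEUTRAL PER HISTORY ON THE LIVE LINE — the record's post-𝐑 top class weight of every history equals its
# `ε`-lettered PRE-𝐑 top weight; hence n20-d's `weightA∕B₁₃` ARE the width-zero gapped weights, and `RelWeightBound` at the gapped carriers (any dials, sub-top
# policies) ⟺ `RelWeightBound` at the reading of record: THE GAPPED ROAD COSTS N20 NOTHING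

R134 seat `pub-ymgap-dag-n21-d` (g12, lane owner N21), strategy s2; key K3⁸ `SpineGivenEndpointR13SepCoPHV` = stmt-QuantumFields-27366, `--kind proof --supports 27366 --as helper`;
COUNT-NEUTRAL.  Theorems only (0 `def`).  Imports V2 `…N21GappedRoadN20Invariance` (dial-freeness of the bad-class sums; through it U6∕U5∕T1∕T2, n20-d's reading, n20-w1's
socket lemmas) — and BY NAME, through the tree: def-R's integrable-currency (0.3)∕(1.102) bookkeeping `B15.BasicStep.integral_normTerm_eq_int` ∕ `suppClause_self_ae`
(`Node00/RStepProvisosIntOfRecord`), dag-n19-c's tower identity `N19MGFRoadLiveSelectorTower.dressedSlotsOfDatum₉_ppSelLive_eq_ppSelId` ∕ `measurable_dressedSlotsOfDatum₉` ∕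
`dressedSlotsOfDatum₉_nonneg`, K0c∕n23-b's `measurable_tstepOfRecord` ∕ `integrable_tstepOfRecord` ∕ `measurable_wOfRecord_of_localBg` ∕ `measurable_chiSeqOfRecord_of_localBg`,
def-T FILE 19's bridges `tstepOfRecordAt_apply` ∕ `wOfRecordAt_apply` ∕ `chiSeqOfRecord_eq_at`.  [III] = [Balaban1988Convergent], [LF-I∕II] = [Balaban1989LargeFieldI∕II].

WHY.  Every file on this seat's threshold-letter road since T1 carried the caveat «the top 𝐑-step is omitted (integral-preserving, (0.4))»: the top-lettered ∕ gapped terms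
are PRE-𝐑 at the top, n20-d's reading of record `weightA∕B₁₃` is POST-𝐑.  On the LIVE-SELECTOR LINE — the only line on which any K5 face is read (v5∕v6 `PinnedAtLive`) —
the 𝐑-step of record is dag-n19-c's identity re-pin (`dressedSlotsOfDatum₉_ppSelLive_eq_ppSelId`), and at the identity selector def-R's (0.3) multiplies the slot of a
history `s′` by ONE ratio `∫⌈_{Z′(s′)} t_{s′} ∕ ∫⌈_{Z′(s′)} t_{s′} ∈ {0, 1}` of its OWN term's fibre integrals; by def-R's integrable (1.102) bookkeeping with the a.e. support
clause of a non-negative integrable piece (`integral_normTerm_eq_int` + `suppClause_self_ae`) the INTEGRATED term is unchanged: `∫ χ_{k+1}(s′)·[𝐑_{k+1}𝐓_k slot_k](s′) =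
∫ χ_{k+1}(s′)·[𝐓_k slot_k](s′)` — HISTORY BY HISTORY, not only in total.  And the pre-𝐑 top term at the letter `ε_{k+1}` IS T1's top-lettered term at `θ = ε_{k+1}` (the top
letter family and def-T's letters of record agree at the two levels the 𝐓-step reads).  So: `classWeightOfDatum₉ … (k+1) t s′ = topClassWeight^{ε_{k+1}}(s′)`; keyed,
`weightA∕B₁₃ = gapWeightA∕B₁₃ … (ρ ≡ 0) n` for EVERY `n`; with V2's dial-freeness, `RelWeightBound` at the gapped carriers `(ρ, n)` ⟺ `RelWeightBound` at n20-d's carriers of record,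
for every policy with `jcut K < K₀ + K ∨ jcut K = 0` — N20's stub-2 conjunct is THE SAME STATEMENT on both roads.

WHAT IS PROVED (kernel; [bookkeeping]; NO estimate).
§49 (generic, any level `j`, any slot family) ★★ `integral_chi_mul_rstepSlot_ppSelId_eq` (the 𝐑-step at the identity selector preserves every history's integrated term: measurable,
  non-negative, integrable term).
§50 (run-generic, `k < p.K`) `wTopAt_eps_eq_wOfRecord₉` · `topSlotAt_eps_eq_tstepOfRecord` · `topClassWeightAt_eps_eq_integral` (T1's objects at `θ = ε_{k+1}` are def-T's of record,
  pre-𝐑) · ★★★ `classWeightOfDatum₉_succ_eq_topClassWeightAt_eps_of_ppSelLive` (on the live line: the record's post-𝐑 class weight at level `k+1` = the `ε_{k+1}`-lettered pre-𝐑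
  top weight; rows (H-ζ), `0 ≤ ζ`, `Σ|ζ| ≤ 1`, `D.AvgMeasurable`, `g 0 = g₀ p.K`).
§51 (at the `CoPH` record, rows `hsel` + (H-ζ)) ★★★ `weightA₁₃_eq_gapWeightA₁₃_widthZero` ∕ `weightB₁₃_eq_gapWeightB₁₃_widthZero` (n20-d's class weights of record = the width-zero
  gapped weights, every key, every depth letter) · ★★★ `relWeightBound_gapCarriers_iff_record` (∀ W: `RelWeightBound 1 (classSet₁₃ …) (gapWeightA₁₃ … ρ n) (gapWeightB₁₃ … ρ n)
  (badClass₁₃ … jcut) W ↔ RelWeightBound 1 (classSet₁₃ …) (weightA₁₃ …) (weightB₁₃ …) (badClass₁₃ … jcut) W`, policies `jcut K < K₀ + K ∨ jcut K = 0`) · ★★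
  `relWeightBound_crGap₁₃VAt_iff_crOfRecord₁₃VAt` (the same at the two READINGS' canonical weights: N20's K5 face at `crGap₁₃VAt` ⟺ at `crOfRecord₁₃VAt K₀ jcut sh`, any `sh`).

HONEST FRAMING (binding).  Bookkeeping BY NAME over def-R's integrable (0.3)∕(1.102) identities, dag-n19-c's tower identity and this seat's V2; NO estimate of Bałaban's;
N20's face itself is NOT proved (K0⁷ OPEN — every ∀-tuple statement is inhabited for no family today); NE7b ∕ NE7c NOT PRINTED for `d = 4`; the identity is proved ON THE LIVE
LINE only (off it the tuple's selector is unconstrained); N20 ∕ N21 NOT discharged; K3⁸ NOT claimed; counts UNMOVED (typed 28∕28 · discharged 5∕27); never a count claim.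
No `sorry`, no `def`, no `instance`, no `notation`; standard axioms.  One finite four-torus programme at fixed `ε` — NOT ℝ⁴, NOT OS, NOT a mass gap, NOT the Clay problem.
-/

set_option autoImplicit false

noncomputable section

open scoped BigOperators
open Finset MeasureTheory

namespace Summit.QuantumFields.YangMills.Theorems.N21ShellSplitOfRecord13CoPH

open Literature.MathematicalPhysics.QuantumFieldTheory.Balaban1983to89
open Literature.MathematicalPhysics.QuantumFieldTheory.Balaban1983to89.T4Continuum
open Literature.MathematicalPhysics.QuantumFieldTheory.Balaban1983to89.Node00
open B14.Eq218Concrete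
open B15.BasicStep (fibreIntegral normTerm integral_normTerm_eq_int suppClause_self_ae)
open YMDAG.UVSplit (SpineReading₁₃CoPH crOfRecord₁₃VAt keyA₁₃ keyB₁₃ runA₁₃ runB₁₃ histA₁₃ histB₁₃ histA₁₃_zero histB₁₃_zero classSet₁₃ weightA₁₃ weightB₁₃ badClass₁₃
  ShellSplit₁₃CoPH)
open T4WeightBudget (RelWeightBound)
open Summit.QuantumFields.YangMills.BalabanUVNodes.SpineCanonicalWeights (admW wInf relWeightBound_wInf relWeightBound_wInf_iff)
open Summit.QuantumFields.YangMills.Theorems.N21StepWeightsPositivity (zetaOfRecord_nonneg)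
open Summit.QuantumFields.YangMills.BalabanUVNodes.N19MGFFormAtRecord (wOfRecord₉_nonneg wOfRecord₉_le_one)
open Summit.QuantumFields.YangMills.BalabanUVNodes.N19MGFRoadLiveSelectorTower (dressedSlotsOfDatum₉_ppSelLive_eq_ppSelId measurable_dressedSlotsOfDatum₉ dressedSlotsOfDatum₉_nonneg)

/-! ## §49 Generic: the 𝐑-step at the identity selector preserves every history's integrated term -/

section RStepId

variable (F : T4Family) (N : ℕ) [NeZero N] (ν : Stage7Numerics) (τ : TowerNumerics) {p : B12.RunParams} {g : ℕ → ℝ} {j : ℕ}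

/-- ★★ **def-R's (0.3) AT THE IDENTITY SELECTOR IS WEIGHT-NEUTRAL PER TERM** (generic `Step.Repr218`, def-R's own currency): for a term `t_a = χ(a)·(𝐓e^A)(a)` that is measurable,
non-negative and integrable, `∫ χ(a)·(𝐓e^A)′(a) dV = ∫ t_a dV` — at `Z″ := Z` the R-stepped slot is `(𝐓e^A)(a)·(∫⌈_{Z′(a)} t_a ∕ ∫⌈_{Z′(a)} t_a)` (`rstepOfSel_id_TexpA`), so the
integrand is def-R's normalised term `normTerm (Z′(a)) t_a t_a`, whose integral is `∫ t_a` by the integrable (1.102) bookkeeping with the a.e. support clause of a non-negative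
integrable piece ([LF-I] (0.4) p.176, (1.102) p.201 — term by term).  The decidability of bond equality is def-R's own (explicit binder, as in `rstepOfSel_id_TexpA`). [bookkeeping] -/
theorem integral_chi_mul_rstepOfSel_id_TexpA_eq (N : ℕ) [NeZero N] {P : Params} {j : ℕ} (iP : DecidableEq (PBond P j)) (r : Step.Repr218 P (SU N) j)
    (fib : r.Adm → Finset (PBond P j)) (a : r.Adm) (hm : Measurable (rterm r a)) (h0 : ∀ V, 0 ≤ rterm r a V)
    (hi : Integrable (rterm r a) (fieldMeasure P j (SU N))) :
    ∫ V, r.χ a V * (rstepOfSel r id fib).TexpA a V ∂fieldMeasure P j (SU N) = ∫ V, rterm r a V ∂fieldMeasure P j (SU N) := by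
  have e : ∀ V, r.χ a V * (rstepOfSel r id fib).TexpA a V = normTerm (fib a) (rterm r a) (rterm r a) V := by
    intro V
    rw [rstepOfSel_id_TexpA N iP r fib a V]
    unfold rratio normTerm rterm
    ring
  simp_rw [e]
  exact integral_normTerm_eq_int (fib a) hm hm h0 h0 hi hi (suppClause_self_ae _ hi (ae_of_all _ h0))

/-- ★★ **THE 𝐑-STEP OF RECORD AT THE IDENTITY SELECTOR IS WEIGHT-NEUTRAL PER HISTORY.**  For a slot family `f` at level `j` and a history `s` whose term `χ_j(s)·f(s)` is
measurable, non-negative and integrable: `∫ χ_j(s)·[𝐑 f](s) dV = ∫ χ_j(s)·f(s) dV` (the record's slice `sliceOfRecord … f` and fibre bond sets `fibOfSeq`; the generic lemma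
above). [bookkeeping] -/
theorem integral_chi_mul_rstepSlot_ppSelId_eq (f : TexpASlot F N ν τ.M p g j) (s : SeqOfRecord F ν τ.M g p.K j)
    (hm : Measurable fun V => chiSeqOfRecord F N ν τ.M g p.K j s V * f s V) (h0 : ∀ V, 0 ≤ chiSeqOfRecord F N ν τ.M g p.K j s V * f s V)
    (hi : Integrable (fun V => chiSeqOfRecord F N ν τ.M g p.K j s V * f s V) (fieldMeasure (F.P p.K) j (SU N))) :
    ∫ V, chiSeqOfRecord F N ν τ.M g p.K j s V * rstepSlot F N ν τ p g j (ppSelIdOfRecord F ν τ.M p g j) f s V ∂fieldMeasure (F.P p.K) j (SU N) =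
      ∫ V, chiSeqOfRecord F N ν τ.M g p.K j s V * f s V ∂fieldMeasure (F.P p.K) j (SU N) := by
  unfold rstepSlot ppSelIdOfRecord
  exact integral_chi_mul_rstepOfSel_id_TexpA_eq N _ (sliceOfRecord F N ν τ.M p g j f) (fibOfSeq F ν τ p g j) s hm h0 hi

end RStepId

/-! ## §50 Run-generic: the record's post-𝐑 class weight at level `k + 1` is the `ε_{k+1}`-lettered PRE-𝐑 top weight, on the live line -/

section PreR

variable (F : T4Family) (N : ℕ) [NeZero N] (ϑ : Stage9Params F N) (D : FiniteEpsData F (SU N)) (g₀ : ℕ → ℝ) (os : List (ULoop F))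
  (p : B12.RunParams) (g : ℕ → ℝ) (k : ℕ)

/-- At the letter `ε_{k+1} := epsOfRecord ν g (k+1)` the top-lettered step weights of step `k` ARE def-T's step weights of record (the 𝐓-step at `(p, g, k)` reads the (3.2) letter
at level `k + 1` only, `wOfRecordAt_apply`; there the top letter family reads `ε_{k+1}` whether or not `k + 1` is the top). [bookkeeping] -/
theorem wTopAt_eps_eq_wOfRecord₉ : wTopAt F N ϑ (epsOfRecord ϑ.ν g (k + 1)) p g k = wOfRecord₉ F N ϑ p g k := by
  unfold wTopAt
  rw [show wOfRecord₉ F N ϑ = wOfRecordAt F N ϑ.ν ϑ.τ9.M (epsLetterOfRecord ϑ.ν) (twoDeltaLetterOfRecord ϑ.ν ϑ.A₁) ϑ.ζ from wOfRecord_eq_at F N ϑ.ν ϑ.τ9.M ϑ.A₁ ϑ.ζ,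
    wOfRecordAt_apply, wOfRecordAt_apply]
  congr 1
  unfold topLetter epsLetterOfRecord
  split_ifs <;> rfl

/-- At `θ = ε_{k+1}` (and `k ≠ p.K`) T1's top-lettered slot IS def-T's pre-𝐑 𝐓-step of record of F3's dressed level-`k` slots. [bookkeeping] -/
theorem topSlotAt_eps_eq_tstepOfRecord (hk : k ≠ p.K) (t : ℝ) (s' : SeqOfRecord F ϑ.ν ϑ.τ9.M g p.K (k + 1)) :
    topSlotAt F N ϑ D g₀ os p g k (epsOfRecord ϑ.ν g (k + 1)) t s' =
      tstepOfRecord F N ϑ.ν ϑ.τ9.M (wOfRecord₉ F N ϑ) p g k (dressedSlotsOfDatum₉ F N ϑ D g₀ os t p g k) s' := by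
  funext V
  rw [topSlotAt_apply, tstepOfRecord_apply, wTopAt_eps_eq_wOfRecord₉, topLetter_of_ne ϑ.ν _ p g hk, ← chiSeqOfRecord_eq_at]

/-- … so T1's top-lettered class weight at `θ = ε_{k+1}` is the integrated PRE-𝐑 top term of record `∫ χ_{k+1}(s′)·[𝐓_k slotᵗ_k](s′)`. [bookkeeping] -/
theorem topClassWeightAt_eps_eq_integral (hk : k ≠ p.K) (t : ℝ) (s' : SeqOfRecord F ϑ.ν ϑ.τ9.M g p.K (k + 1)) :
    topClassWeightAt F N ϑ D g₀ os p g k (epsOfRecord ϑ.ν g (k + 1)) t s' =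
      ∫ V, chiSeqOfRecord F N ϑ.ν ϑ.τ9.M g p.K (k + 1) s' V *
        tstepOfRecord F N ϑ.ν ϑ.τ9.M (wOfRecord₉ F N ϑ) p g k (dressedSlotsOfDatum₉ F N ϑ D g₀ os t p g k) s' V ∂fieldMeasure (F.P p.K) (k + 1) (SU N) := by
  unfold topClassWeightAt
  rw [topSlotAt_eps_eq_tstepOfRecord F N ϑ D g₀ os p g k hk, ← chiSeqOfRecord_eq_at]

/-- ★★★ **ON THE LIVE LINE THE RECORD's POST-𝐑 CLASS WEIGHT AT LEVEL `k + 1` IS THE `ε_{k+1}`-LETTERED PRE-𝐑 TOP WEIGHT, HISTORY BY HISTORY** (`k < p.K`; rows: the live-selector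
pin, `g 0 = g₀ p.K`, `D.AvgMeasurable`, (H-ζ), `0 ≤ ζ`, `Σ|ζ| ≤ 1`): `classWeightOfDatum₉ ϑ D g₀ os p g (k+1) t s′ = topClassWeight^{ε_{k+1}}(s′)`.  Proof: dag-n19-c's tower identity
(live re-pin = identity re-pin, pointwise), F3's recursion (`texpAOfRecordFrom_succ`), §49 at the identity selector, and the letter bridges above.  The caveat «top 𝐑-step omitted»
of T1 ∕ R1 ∕ U1 ∕ U5 is thereby VOID for class weights on the live line. [bookkeeping] -/
theorem classWeightOfDatum₉_succ_eq_topClassWeightAt_eps_of_ppSelLive (E : B12.RunParams → ℝ)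
    (hsel : ϑ.ppSel = ppSelLiveOfRecord F N ϑ.ν ϑ.τ9 E (wOfRecord₉ F N ϑ)) (hg : g 0 = g₀ p.K) (hD : D.AvgMeasurable)
    (hζ0 : ∀ p g k s Pl Ql RS U V', 0 ≤ ϑ.ζ p g k s Pl Ql RS U V') (hζm : ZetaMeasurable F N ϑ.ζ) (hζ1 : IsZetaAbsLeOne F N ϑ.ν ϑ.τ9.M ϑ.ζ)
    (hk : k < p.K) (t : ℝ) (s' : SeqOfRecord F ϑ.ν ϑ.τ9.M g p.K (k + 1))
    (hint : ∀ s : SeqOfRecord F ϑ.ν ϑ.τ9.M g p.K k,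
      Integrable (fun U => chiSeqOfRecord F N ϑ.ν ϑ.τ9.M g p.K k s U * dressedSlotsOfDatum₉ F N ϑ D g₀ os t p g k s U) (fieldMeasure (F.P p.K) k (SU N))) :
    classWeightOfDatum₉ F N ϑ D g₀ os p g (k + 1) t s' = topClassWeightAt F N ϑ D g₀ os p g k (epsOfRecord ϑ.ν g (k + 1)) t s' := by
  have hU : LocalBgMeasurable F N ϑ.ν := localBgMeasurable F N ϑ.ν
  have hw0 : ∀ k s' U V', 0 ≤ wOfRecord₉ F N ϑ p g k s' U V' := wOfRecord₉_nonneg ϑ hζ0 p g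
  have hwm : ∀ k (s' : SeqOfRecord F ϑ.ν ϑ.τ9.M g p.K (k + 1)),
      Measurable (fun z : GaugeField (F.P p.K) (k + 1) (SU N) × GaugeField (F.P p.K) k (SU N) => wOfRecord₉ F N ϑ p g k s' z.2 z.1) :=
    fun k s' => measurable_wOfRecord_of_localBg hU ϑ.τ9.M ϑ.A₁ hζm p g k s'
  have hχm : ∀ k (s : SeqOfRecord F ϑ.ν ϑ.τ9.M g p.K k), Measurable (chiSeqOfRecord F N ϑ.ν ϑ.τ9.M g p.K k s) :=
    fun k s => measurable_chiSeqOfRecord_of_localBg hU ϑ.τ9.M g p.K k s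
  -- the ϑ-objects the pre-𝐑 top term is made of
  set f : TexpASlot F N ϑ.ν ϑ.τ9.M p g (k + 1) :=
    tstepOfRecord F N ϑ.ν ϑ.τ9.M (wOfRecord₉ F N ϑ) p g k (dressedSlotsOfDatum₉ F N ϑ D g₀ os t p g k) with hf
  have hfm : Measurable (f s') :=
    measurable_tstepOfRecord F N ϑ.ν ϑ.τ9.M (hwm k) (measurable_dressedSlotsOfDatum₉ F N ϑ D g₀ os p g hD hwm hχm t k) (hχm k) s'
  have hf0 : ∀ V, 0 ≤ f s' V := fun V =>
    tstepOfRecord_nonneg F N ϑ.ν ϑ.τ9.M (hw0 k) (dressedSlotsOfDatum₉_nonneg F N ϑ D g₀ os p g hw0 t k) s' V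
  have hfi : Integrable (f s') (fieldMeasure (F.P p.K) (k + 1) (SU N)) :=
    integrable_tstepOfRecord F N ϑ.ν ϑ.τ9.M hk (hwm k) (fun s'' U V' => abs_wOfRecord_le_one F N ϑ.ν ϑ.τ9.M ϑ.A₁ hζ1 p g k s'' U V') hint s'
  have htm : Measurable fun V => chiSeqOfRecord F N ϑ.ν ϑ.τ9.M g p.K (k + 1) s' V * f s' V := (hχm (k + 1) s').mul hfm
  have ht0 : ∀ V, 0 ≤ chiSeqOfRecord F N ϑ.ν ϑ.τ9.M g p.K (k + 1) s' V * f s' V :=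
    fun V => mul_nonneg (chiSeqOfRecord_nonneg F N ϑ.ν ϑ.τ9.M g p.K (k + 1) s' V) (hf0 V)
  have hti : Integrable (fun V => chiSeqOfRecord F N ϑ.ν ϑ.τ9.M g p.K (k + 1) s' V * f s' V) (fieldMeasure (F.P p.K) (k + 1) (SU N)) :=
    hfi.bdd_mul (c := 1) (hχm (k + 1) s').aestronglyMeasurable
      (ae_of_all _ fun V => by rw [Real.norm_eq_abs]; exact abs_chiSeqOfRecord_le_one F N ϑ.ν ϑ.τ9.M g p.K (k + 1) s' V)
  -- live re-pin = identity re-pin (dag-n19-c), then F3's recursion at the identity selector, then §49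
  rw [topClassWeightAt_eps_eq_integral F N ϑ D g₀ os p g k (Nat.ne_of_lt hk) t s',
    Summit.QuantumFields.YangMills.BalabanUVNodes.N19MGFRoadLiveSelectorTower.classWeightOfDatum₉_ppSelLive_eq_ppSelId F N ϑ D g₀ os p g E hsel hg hD hw0 hwm hχm
      (k + 1) t s']
  unfold classWeightOfDatum₉
  have hslot : ∀ V, dressedSlotsOfDatum₉ F N { ϑ with ppSel := ppSelIdOfRecord F ϑ.ν ϑ.τ9.M } D g₀ os t p g (k + 1) s' V =
      rstepSlot F N ϑ.ν ϑ.τ9 p g (k + 1) (ppSelIdOfRecord F ϑ.ν ϑ.τ9.M p g (k + 1)) f s' V := by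
    intro V
    have hlow : dressedSlotsOfDatum₉ F N { ϑ with ppSel := ppSelIdOfRecord F ϑ.ν ϑ.τ9.M } D g₀ os t p g k =
        dressedSlotsOfDatum₉ F N ϑ D g₀ os t p g k :=
      funext fun s => funext fun U => (dressedSlotsOfDatum₉_ppSelLive_eq_ppSelId F N ϑ D g₀ os p g E hsel hg hD hw0 hwm hχm t k s U).symm
    show texpAOfRecordFrom F N ϑ.ν ϑ.τ9.M _ _ _ p g (k + 1) s' V = _
    rw [texpAOfRecordFrom_succ]
    show rstepSlot F N ϑ.ν ϑ.τ9 p g (k + 1) (ppSelIdOfRecord F ϑ.ν ϑ.τ9.M p g (k + 1))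
        (tstepOfRecord F N ϑ.ν ϑ.τ9.M (wOfRecord₉ F N ϑ) p g k
          (dressedSlotsOfDatum₉ F N { ϑ with ppSel := ppSelIdOfRecord F ϑ.ν ϑ.τ9.M } D g₀ os t p g k)) s' V = _
    rw [hlow]
  simp_rw [hslot]
  exact integral_chi_mul_rstepSlot_ppSelId_eq F N ϑ.ν ϑ.τ9 f s' htm ht0 hti

/-- **LEVEL FORM** (`j ≤ p.K`): on the live line the record's class weight at level `j` IS R1's top-lettered term at the letter of record `ε_j` — level `0`: both are the record's
level-`0` weight; level `k + 1`: the theorem above. [bookkeeping] -/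
theorem classWeightOfDatum₉_eq_topTermAtLevel_eps_of_ppSelLive (E : B12.RunParams → ℝ)
    (hsel : ϑ.ppSel = ppSelLiveOfRecord F N ϑ.ν ϑ.τ9 E (wOfRecord₉ F N ϑ)) (hg : g 0 = g₀ p.K) (hD : D.AvgMeasurable)
    (hζ0 : ∀ p g k s Pl Ql RS U V', 0 ≤ ϑ.ζ p g k s Pl Ql RS U V') (hζm : ZetaMeasurable F N ϑ.ζ) (hζ1 : IsZetaAbsLeOne F N ϑ.ν ϑ.τ9.M ϑ.ζ) (t : ℝ)
    (hint : ∀ k, k < p.K → ∀ s : SeqOfRecord F ϑ.ν ϑ.τ9.M g p.K k,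
      Integrable (fun U => chiSeqOfRecord F N ϑ.ν ϑ.τ9.M g p.K k s U * dressedSlotsOfDatum₉ F N ϑ D g₀ os t p g k s U) (fieldMeasure (F.P p.K) k (SU N))) :
    ∀ (j : ℕ), j ≤ p.K → ∀ s : SeqOfRecord F ϑ.ν ϑ.τ9.M g p.K j,
      classWeightOfDatum₉ F N ϑ D g₀ os p g j t s = topTermAtLevel F N ϑ D g₀ os p g (epsOfRecord ϑ.ν g j) t j s := by
  intro j hj s
  cases j with
  | zero => simp only [topTermAtLevel_zero]
  | succ k =>
    simp only [topTermAtLevel_succ]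
    exact classWeightOfDatum₉_succ_eq_topClassWeightAt_eps_of_ppSelLive F N ϑ D g₀ os p g k E hsel hg hD hζ0 hζm hζ1 (by omega) t s (hint k (by omega))

end PreR

/-! ## §51 At the `CoPH`-keyed Stage-13 record: n20-d's class weights of record ARE the width-zero gapped weights; `RelWeightBound` at the gapped carriers ⟺ at the record's -/

section Record

variable {F : T4Family} {N : ℕ} [NeZero N] (K₀ : ℕ) (θ : Stage13HParams F N) (hP : θ.Provisos₁₃CoPH F N) (g₀ : ℕ → ℝ) (os : List (ULoop F))

/-- ★★★ **n20-d's RUN-A CLASS WEIGHT OF RECORD IS THE WIDTH-ZERO GAPPED WEIGHT, EVERY KEY, EVERY DEPTH LETTER** (live-selector line, (H-ζ)): `weightA₁₃ θ hP K₀ g₀ os K t x =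
gapWeightA₁₃ θ hP K₀ g₀ os (ρ ≡ 0) n K t x` — both are fibre sums along `keyA₁₃`; termwise the record's post-𝐑 top weight is the `ε`-lettered pre-𝐑 one (§50) and at width
`0` every grid letter is `ε` (R4 `cutGrid_width_zero`). [bookkeeping] -/
theorem weightA₁₃_eq_gapWeightA₁₃_widthZero (E : B12.RunParams → ℝ) (hsel : θ.ppSel = ppSelLiveOfRecord F N θ.ν θ.τ9 E (wOfRecord₉ F N θ.toStage9Params))
    (hζm : ZetaMeasurable F N θ.ζ) (n : ℕ → ℕ) (K : ℕ) (t : ℝ) (x : Σ K, SiteSeqKey F (K₀ + K)) :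
    weightA₁₃ θ hP K₀ g₀ os K t x = gapWeightA₁₃ θ hP K₀ g₀ os (fun _ => 0) n K t x := by
  have hζ0 : ∀ p g k s Pl Ql RS U V', 0 ≤ θ.ζ p g k s Pl Ql RS U V' :=
    fun p g k s Pl Ql RS U V' => zetaOfRecord_nonneg F N θ.ν θ.τ9.M hP.zetaUnity hP.zetaAbs p g k s Pl Ql RS U V'
  have hU : LocalBgMeasurable F N θ.ν := localBgMeasurable F N θ.ν
  have hD : (datumOfRecord₁₃CoPH F N θ hP).AvgMeasurable := (isPrintedAveraged_datumOfRecord₁₃CoPH F N θ hP).avgMeasurable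
  unfold weightA₁₃ gapWeightA₁₃
  refine Finset.sum_congr rfl fun s _ => ?_
  simp only [cutGrid_width_zero]
  exact classWeightOfDatum₉_eq_topTermAtLevel_eps_of_ppSelLive F N θ.toStage9Params (datumOfRecord₁₃CoPH F N θ hP) g₀ os (runA₁₃ F K₀ g₀ K)
    (histA₁₃ θ K₀ g₀ K) E hsel (histA₁₃_zero θ K₀ g₀ K) hD hζ0 hζm hP.zetaAbs t
    (fun k hk s => integrable_chi_mul_dressedSlots_of_ppSelLive θ.toStage9Params E hsel hU hζm hζ0 hP.zetaAbs _ hD g₀ os (histA₁₃_zero θ K₀ g₀ K) t k s)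
    (K₀ + K) le_rfl s

/-- ★★★ **… AND RUN B's.** [bookkeeping] -/
theorem weightB₁₃_eq_gapWeightB₁₃_widthZero (E : B12.RunParams → ℝ) (hsel : θ.ppSel = ppSelLiveOfRecord F N θ.ν θ.τ9 E (wOfRecord₉ F N θ.toStage9Params))
    (hζm : ZetaMeasurable F N θ.ζ) (n : ℕ → ℕ) (K : ℕ) (t : ℝ) (x : Σ K, SiteSeqKey F (K₀ + K)) :
    weightB₁₃ θ hP K₀ g₀ os K t x = gapWeightB₁₃ θ hP K₀ g₀ os (fun _ => 0) n K t x := by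
  have hζ0 : ∀ p g k s Pl Ql RS U V', 0 ≤ θ.ζ p g k s Pl Ql RS U V' :=
    fun p g k s Pl Ql RS U V' => zetaOfRecord_nonneg F N θ.ν θ.τ9.M hP.zetaUnity hP.zetaAbs p g k s Pl Ql RS U V'
  have hU : LocalBgMeasurable F N θ.ν := localBgMeasurable F N θ.ν
  have hD : (datumOfRecord₁₃CoPH F N θ hP).AvgMeasurable := (isPrintedAveraged_datumOfRecord₁₃CoPH F N θ hP).avgMeasurable
  unfold weightB₁₃ gapWeightB₁₃
  refine Finset.sum_congr rfl fun s' _ => ?_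
  simp only [cutGrid_width_zero]
  exact classWeightOfDatum₉_eq_topTermAtLevel_eps_of_ppSelLive F N θ.toStage9Params (datumOfRecord₁₃CoPH F N θ hP) g₀ os (runB₁₃ F K₀ g₀ K)
    (histB₁₃ θ K₀ g₀ K) E hsel (histB₁₃_zero θ K₀ g₀ K) hD hζ0 hζm hP.zetaAbs t
    (fun k hk s => integrable_chi_mul_dressedSlots_of_ppSelLive θ.toStage9Params E hsel hU hζm hζ0 hP.zetaAbs _ hD g₀ os (histB₁₃_zero θ K₀ g₀ K) t k s)
    (K₀ + K + 1) le_rfl s'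

/-- ★★ **`RelWeightBound` AT n20-d's CARRIERS OF RECORD ⟺ AT THE WIDTH-ZERO GAPPED CARRIERS** (every `W`, every policy `jcut`, every depth letter `n`; live line, (H-ζ)) — the two
weight families coincide as functions. [bookkeeping] -/
theorem relWeightBound_record_iff_gapCarriers_widthZero (E : B12.RunParams → ℝ) (hsel : θ.ppSel = ppSelLiveOfRecord F N θ.ν θ.τ9 E (wOfRecord₉ F N θ.toStage9Params))
    (hζm : ZetaMeasurable F N θ.ζ) (jcut : ℕ → ℕ) (n : ℕ → ℕ) (W : ℕ → ℝ) :
    RelWeightBound 1 (classSet₁₃ θ K₀ g₀) (weightA₁₃ θ hP K₀ g₀ os) (weightB₁₃ θ hP K₀ g₀ os) (badClass₁₃ θ K₀ g₀ jcut) W ↔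
      RelWeightBound 1 (classSet₁₃ θ K₀ g₀) (gapWeightA₁₃ θ hP K₀ g₀ os (fun _ => 0) n) (gapWeightB₁₃ θ hP K₀ g₀ os (fun _ => 0) n) (badClass₁₃ θ K₀ g₀ jcut) W := by
  have hA : weightA₁₃ θ hP K₀ g₀ os = gapWeightA₁₃ θ hP K₀ g₀ os (fun _ => 0) n :=
    funext fun K => funext fun t => funext fun x => weightA₁₃_eq_gapWeightA₁₃_widthZero K₀ θ hP g₀ os E hsel hζm n K t x
  have hB : weightB₁₃ θ hP K₀ g₀ os = gapWeightB₁₃ θ hP K₀ g₀ os (fun _ => 0) n :=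
    funext fun K => funext fun t => funext fun x => weightB₁₃_eq_gapWeightB₁₃_widthZero K₀ θ hP g₀ os E hsel hζm n K t x
  rw [hA, hB]


/-- ★ **AT WIDTH ZERO THE GAPPED READING HAS THE RECORD's CLASS WEIGHTS** (A6 consistency with U7's «ρ_K = 0 ⇒ zero split»): on the live line under (H-ζ) the `A`∕`B` fields of
`crGap₁₃VAt N K₀ jcut (ρ ≡ 0) n` ARE n20-d's `weightA∕B₁₃` — those of `crOfRecord₁₃VAt K₀ jcut sh` (any `sh`). [bookkeeping] -/
theorem crGap₁₃VAt_A_B_widthZero_eq (jcut : ℕ → ℕ) (n : DepthLetter₁₃CoPH N) (sh : ShellSplit₁₃CoPH N K₀) (E : B12.RunParams → ℝ)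
    (hsel : θ.ppSel = ppSelLiveOfRecord F N θ.ν θ.τ9 E (wOfRecord₉ F N θ.toStage9Params)) (hζm : ZetaMeasurable F N θ.ζ) :
    (crGap₁₃VAt N K₀ jcut (fun _ _ _ _ _ _ => 0) n F θ hP g₀ os).A = (crOfRecord₁₃VAt K₀ jcut sh F θ hP g₀ os).A ∧
      (crGap₁₃VAt N K₀ jcut (fun _ _ _ _ _ _ => 0) n F θ hP g₀ os).B = (crOfRecord₁₃VAt K₀ jcut sh F θ hP g₀ os).B :=
  ⟨(funext fun K => funext fun t => funext fun x => weightA₁₃_eq_gapWeightA₁₃_widthZero K₀ θ hP g₀ os E hsel hζm (n F θ hP g₀ os) K t x).symm,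
    (funext fun K => funext fun t => funext fun x => weightB₁₃_eq_gapWeightB₁₃_widthZero K₀ θ hP g₀ os E hsel hζm (n F θ hP g₀ os) K t x).symm⟩

/-- The admissible relative weights of the bad class are the SAME SET at the gapped carriers `(ρ, n)` and at n20-d's carriers of record (policy `jcut K < K₀ + K ∨ jcut K = 0`;
live line, (H-ζ)) — the four sums in `admW` agree: bad sums by V2's dial-freeness + §51, totals by E1∕E2. [bookkeeping] -/
theorem admW_gapCarriers_eq_record (E : B12.RunParams → ℝ) (hsel : θ.ppSel = ppSelLiveOfRecord F N θ.ν θ.τ9 E (wOfRecord₉ F N θ.toStage9Params))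
    (hζm : ZetaMeasurable F N θ.ζ) (jcut : ℕ → ℕ) (ρ : ℕ → ℝ) (n : ℕ → ℕ) (K : ℕ) (hj : jcut K < K₀ + K ∨ jcut K = 0) :
    admW 1 (classSet₁₃ θ K₀ g₀) (gapWeightA₁₃ θ hP K₀ g₀ os ρ n) (gapWeightB₁₃ θ hP K₀ g₀ os ρ n) (badClass₁₃ θ K₀ g₀ jcut) K =
      admW 1 (classSet₁₃ θ K₀ g₀) (weightA₁₃ θ hP K₀ g₀ os) (weightB₁₃ θ hP K₀ g₀ os) (badClass₁₃ θ K₀ g₀ jcut) K := by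
  have hA : weightA₁₃ θ hP K₀ g₀ os = gapWeightA₁₃ θ hP K₀ g₀ os (fun _ => 0) n :=
    funext fun K => funext fun t => funext fun x => weightA₁₃_eq_gapWeightA₁₃_widthZero K₀ θ hP g₀ os E hsel hζm n K t x
  have hB : weightB₁₃ θ hP K₀ g₀ os = gapWeightB₁₃ θ hP K₀ g₀ os (fun _ => 0) n :=
    funext fun K => funext fun t => funext fun x => weightB₁₃_eq_gapWeightB₁₃_widthZero K₀ θ hP g₀ os E hsel hζm n K t x
  rw [hA, hB]
  ext w
  simp only [admW, Set.mem_setOf_eq]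
  refine and_congr_right fun _ => forall_congr' fun t => forall_congr' fun _ => ?_
  rw [sum_badClass₁₃_gapWeightA₁₃_letter_free θ hP K₀ g₀ os jcut E hsel hζm ρ n (fun _ => 0) n K t hj,
    sum_badClass₁₃_gapWeightB₁₃_letter_free θ hP K₀ g₀ os jcut E hsel hζm ρ n (fun _ => 0) n K t hj,
    sum_classSet₁₃_gapWeightA₁₃_eq_schemeZ K₀ θ hP g₀ os E hsel hζm, sum_classSet₁₃_gapWeightA₁₃_eq_schemeZ K₀ θ hP g₀ os E hsel hζm,
    sum_classSet₁₃_gapWeightB₁₃_eq_schemeZ K₀ θ hP g₀ os E hsel hζm, sum_classSet₁₃_gapWeightB₁₃_eq_schemeZ K₀ θ hP g₀ os E hsel hζm]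

/-- ★★ **THE CANONICAL RELATIVE WEIGHT OF THE BAD CLASS IS THE SAME NUMBER** at the gapped carriers `(ρ, n)` and at the carriers of record (dag-n20-w2's junction «`W_crGap₁₃VAt =
W_crOfRecord₁₃VAt` below the top», first refusal taken): `wInf 1 T (gapWeightA₁₃ … ρ n) (gapWeightB₁₃ … ρ n) Bad K = wInf 1 T weightA₁₃ weightB₁₃ Bad K`. [bookkeeping] -/
theorem wInf_gapCarriers_eq_record (E : B12.RunParams → ℝ) (hsel : θ.ppSel = ppSelLiveOfRecord F N θ.ν θ.τ9 E (wOfRecord₉ F N θ.toStage9Params))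
    (hζm : ZetaMeasurable F N θ.ζ) (jcut : ℕ → ℕ) (ρ : ℕ → ℝ) (n : ℕ → ℕ) (K : ℕ) (hj : jcut K < K₀ + K ∨ jcut K = 0) :
    wInf 1 (classSet₁₃ θ K₀ g₀) (gapWeightA₁₃ θ hP K₀ g₀ os ρ n) (gapWeightB₁₃ θ hP K₀ g₀ os ρ n) (badClass₁₃ θ K₀ g₀ jcut) K =
      wInf 1 (classSet₁₃ θ K₀ g₀) (weightA₁₃ θ hP K₀ g₀ os) (weightB₁₃ θ hP K₀ g₀ os) (badClass₁₃ θ K₀ g₀ jcut) K := by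
  unfold wInf
  rw [admW_gapCarriers_eq_record K₀ θ hP g₀ os E hsel hζm jcut ρ n K hj]

/-- ★★★ **`RelWeightBound` AT THE GAPPED CARRIERS ⟺ AT n20-d's CARRIERS OF RECORD — THE GAPPED ROAD COSTS N20 NOTHING** (every `W`; policies `jcut K < K₀ + K ∨ jcut K = 0`;
live line, (H-ζ)): V2's dial-freeness `(ρ, n) ↔ (0, n)` composed with §51's `(0, n) =` record.  N20's K5 conjunct is the same statement on both roads; N20's face itself is NOT
proved here. [bookkeeping] -/
theorem relWeightBound_gapCarriers_iff_record (E : B12.RunParams → ℝ) (hsel : θ.ppSel = ppSelLiveOfRecord F N θ.ν θ.τ9 E (wOfRecord₉ F N θ.toStage9Params))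
    (hζm : ZetaMeasurable F N θ.ζ) (jcut : ℕ → ℕ) (hj : ∀ K, jcut K < K₀ + K ∨ jcut K = 0) (ρ : ℕ → ℝ) (n : ℕ → ℕ) (W : ℕ → ℝ) :
    RelWeightBound 1 (classSet₁₃ θ K₀ g₀) (gapWeightA₁₃ θ hP K₀ g₀ os ρ n) (gapWeightB₁₃ θ hP K₀ g₀ os ρ n) (badClass₁₃ θ K₀ g₀ jcut) W ↔
      RelWeightBound 1 (classSet₁₃ θ K₀ g₀) (weightA₁₃ θ hP K₀ g₀ os) (weightB₁₃ θ hP K₀ g₀ os) (badClass₁₃ θ K₀ g₀ jcut) W :=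
  (relWeightBound_gapCarriers_iff θ hP K₀ g₀ os jcut E hsel hζm hj ρ n (fun _ => 0) n W).trans
    (relWeightBound_record_iff_gapCarriers_widthZero K₀ θ hP g₀ os E hsel hζm jcut n W).symm

/-- ★★ **N20's K5 FACE AT THE GAPPED READING ⟺ AT THE READING OF RECORD**, at the two readings' CANONICAL weights (n20-d's `relWeightBound_wInf_iff` on both sides; any shell split
`sh` — `RelWeightBound` does not read the shells): `RelWeightBound` of `crGap₁₃VAt N K₀ jcut ρ n` ⟺ `RelWeightBound` of `crOfRecord₁₃VAt K₀ jcut sh`, per tuple on the live line under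
(H-ζ), for policies `jcut K < K₀ + K ∨ jcut K = 0`. [bookkeeping] -/
theorem relWeightBound_crGap₁₃VAt_iff_crOfRecord₁₃VAt (jcut : ℕ → ℕ) (hj : ∀ K, jcut K < K₀ + K ∨ jcut K = 0) (ρ : WidthLetter₁₃CoPH N) (n : DepthLetter₁₃CoPH N)
    (sh : ShellSplit₁₃CoPH N K₀) (E : B12.RunParams → ℝ) (hsel : θ.ppSel = ppSelLiveOfRecord F N θ.ν θ.τ9 E (wOfRecord₉ F N θ.toStage9Params)) (hζm : ZetaMeasurable F N θ.ζ) :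
    RelWeightBound (crGap₁₃VAt N K₀ jcut ρ n F θ hP g₀ os).l₀ (crGap₁₃VAt N K₀ jcut ρ n F θ hP g₀ os).T (crGap₁₃VAt N K₀ jcut ρ n F θ hP g₀ os).A
        (crGap₁₃VAt N K₀ jcut ρ n F θ hP g₀ os).B (crGap₁₃VAt N K₀ jcut ρ n F θ hP g₀ os).Bad (crGap₁₃VAt N K₀ jcut ρ n F θ hP g₀ os).W ↔
      RelWeightBound (crOfRecord₁₃VAt K₀ jcut sh F θ hP g₀ os).l₀ (crOfRecord₁₃VAt K₀ jcut sh F θ hP g₀ os).T (crOfRecord₁₃VAt K₀ jcut sh F θ hP g₀ os).A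
        (crOfRecord₁₃VAt K₀ jcut sh F θ hP g₀ os).B (crOfRecord₁₃VAt K₀ jcut sh F θ hP g₀ os).Bad (crOfRecord₁₃VAt K₀ jcut sh F θ hP g₀ os).W := by
  show RelWeightBound 1 (classSet₁₃ θ K₀ g₀) (gapWeightA₁₃ θ hP K₀ g₀ os (ρ F θ hP g₀ os) (n F θ hP g₀ os)) (gapWeightB₁₃ θ hP K₀ g₀ os (ρ F θ hP g₀ os) (n F θ hP g₀ os))
      (badClass₁₃ θ K₀ g₀ jcut) (wInf 1 (classSet₁₃ θ K₀ g₀) (gapWeightA₁₃ θ hP K₀ g₀ os (ρ F θ hP g₀ os) (n F θ hP g₀ os))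
        (gapWeightB₁₃ θ hP K₀ g₀ os (ρ F θ hP g₀ os) (n F θ hP g₀ os)) (badClass₁₃ θ K₀ g₀ jcut)) ↔
    RelWeightBound 1 (classSet₁₃ θ K₀ g₀) (weightA₁₃ θ hP K₀ g₀ os) (weightB₁₃ θ hP K₀ g₀ os) (badClass₁₃ θ K₀ g₀ jcut)
      (wInf 1 (classSet₁₃ θ K₀ g₀) (weightA₁₃ θ hP K₀ g₀ os) (weightB₁₃ θ hP K₀ g₀ os) (badClass₁₃ θ K₀ g₀ jcut))
  rw [relWeightBound_wInf_iff, relWeightBound_wInf_iff]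
  exact exists_congr fun W => relWeightBound_gapCarriers_iff_record K₀ θ hP g₀ os E hsel hζm jcut hj _ _ W

end Record

end Summit.QuantumFields.YangMills.Theorems.N21ShellSplitOfRecord13CoPH

end
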